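import Summits.Ventures.DiscreteObjects.Hadamard.ConferenceGraph333Order66
import Summits.Ventures.DiscreteObjects.Hadamard.ConferenceGraph333Normalizer83Index

/-!
# Gen-32 summary: orders `33`, `66` and the `83`- and `41`-local group structure of Aut(srg(333,166,82,83)) (kernel, one statement)

Framing: lottery ticket; floor = certified bounds/negative ranges.  Cell pub-namedobj (venture DiscreteObjects),
target (H) = `H(668)`, hadamard gen 32.  One-statement packaging (restatements only, no new content) of the gen-32 files
`ConferenceGraph333Order33`, `…Order66`, `…CentralizerCards`, `…Normalizer83`, `…Normalizer83Index`: for an `srg(333,166,82,83)` with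
adjacency matrix `A`,
(1) an automorphism of order `33` has `#Fix σ = 1`, `#Fix σ³ = 25`, `#Fix σ¹¹ = 45` (unique cycle type `33⁸·11⁴·3⁸·1¹`);
(2) an automorphism of order `66` has `#Fix σ = #Fix σ² = 1`, `#Fix σ⁶ = 25`, `#Fix σ²² = 45`, `(#Fix σ³, #Fix σ¹¹, #Fix σ³³) ∈ {(1,1,1),(1,45,45),(13,1,145)}`;
(3) a group of automorphisms centralising a member of order `83` has order `83` or `166`, of order `41`: `41` or `82`;
(4) a group of automorphisms normalising `⟨ρ⟩`, `ρ` a member of order `83`, has order dividing `332`.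
WORDS: structure of a HYPOTHETICAL object; no Hadamard order excluded; ours (PROVISIONAL).  No `sorry`, no new definitions.
-/

namespace Summit.Ventures.DiscreteObjects.Hadamard

open Finset

section summaryG32
variable {V : Type*} [Fintype V] [DecidableEq V]

/-- **Gen-32 census summary (orders 33, 66; centralisers of 83/41; normaliser of 83), one statement.** -/
theorem local_structure_summary_g32 (hV : Fintype.card V = 333) (A : Matrix V V ℤ)
    (h01 : ∀ x y, A x y = 0 ∨ A x y = 1) (hsymm : ∀ x y, A y x = A x y) (hdiag : ∀ x, A x x = 0)
    (hk : ∀ x, ∑ y, A x y = 166) (hsrg : ∀ x y, ∑ z, A x z * A z y = 83 * (1 + (if x = y then 1 else 0)) - A x y) :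
    -- (1) order 33
    (∀ σ : Equiv.Perm V, σ ^ 33 = 1 → σ ^ 11 ≠ 1 → σ ^ 3 ≠ 1 → (∀ x y, A (σ x) (σ y) = A x y) →
      (univ.filter fun x => σ x = x).card = 1 ∧ (univ.filter fun x => (σ ^ 3) x = x).card = 25 ∧
        (univ.filter fun x => (σ ^ 11) x = x).card = 45) ∧
    -- (2) order 66
    (∀ σ : Equiv.Perm V, σ ^ 66 = 1 → σ ^ 33 ≠ 1 → σ ^ 22 ≠ 1 → σ ^ 6 ≠ 1 → (∀ x y, A (σ x) (σ y) = A x y) →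
      (univ.filter fun x => σ x = x).card = 1 ∧ (univ.filter fun x => (σ ^ 2) x = x).card = 1 ∧
      (univ.filter fun x => (σ ^ 6) x = x).card = 25 ∧ (univ.filter fun x => (σ ^ 22) x = x).card = 45 ∧
      (((univ.filter fun x => (σ ^ 3) x = x).card = 1 ∧ (univ.filter fun x => (σ ^ 11) x = x).card = 1 ∧
          (univ.filter fun x => (σ ^ 33) x = x).card = 1) ∨
       ((univ.filter fun x => (σ ^ 3) x = x).card = 1 ∧ (univ.filter fun x => (σ ^ 11) x = x).card = 45 ∧
          (univ.filter fun x => (σ ^ 33) x = x).card = 45) ∨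
       ((univ.filter fun x => (σ ^ 3) x = x).card = 13 ∧ (univ.filter fun x => (σ ^ 11) x = x).card = 1 ∧
          (univ.filter fun x => (σ ^ 33) x = x).card = 145))) ∧
    -- (3) centralisers at 83 and 41
    (∀ (C : Subgroup (Equiv.Perm V)) (ρ : Equiv.Perm V), (∀ g ∈ C, ∀ x y, A (g x) (g y) = A x y) → ρ ≠ 1 → ρ ∈ C →
      (∀ g ∈ C, g * ρ = ρ * g) →
      (ρ ^ 83 = 1 → Nat.card C = 83 ∨ Nat.card C = 166) ∧ (ρ ^ 41 = 1 → Nat.card C = 41 ∨ Nat.card C = 82)) ∧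
    -- (4) normaliser at 83
    (∀ (N : Subgroup (Equiv.Perm V)) (ρ : Equiv.Perm V), (∀ g ∈ N, ∀ x y, A (g x) (g y) = A x y) → ρ ^ 83 = 1 → ρ ≠ 1 → ρ ∈ N →
      (∀ g ∈ N, ∃ m : ℕ, g * ρ = ρ ^ m * g) → Nat.card N ∣ 332) := by
  refine ⟨fun σ h33 h11 h3 hA => aut_order33_unique_type hV A h01 hsymm hdiag hk hsrg σ h33 h11 h3 hA,
    fun σ h66 h33 h22 h6 hA => aut_order66_census hV A h01 hsymm hdiag hk hsrg σ h66 h33 h22 h6 hA,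
    fun C ρ hC hρ1 hρC hcomm => ⟨fun hρ => ?_, fun hρ => ?_⟩,
    fun N ρ hN hρ hρ1 hρN hnorm => normalizer83_card_dvd_332 hV A h01 hsymm hdiag hk hsrg N hN ρ hρ hρ1 hρN hnorm⟩
  · exact centralizer83_card hV A h01 hsymm hdiag hk hsrg C hC ρ hρ hρ1 hρC hcomm
  · exact centralizer41_card hV A h01 hsymm hdiag hk hsrg C hC ρ hρ hρ1 hρC hcomm

end summaryG32

end Summit.Ventures.DiscreteObjects.Hadamard
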